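import Literature.NumberTheory.PAdicHodge.KummerFilZeroCoboundaryRationalPoints
import Literature.NumberTheory.PAdicHodge.DeRhamOfTatePtPeriods
import Literature.NumberTheory.GaloisRepresentations.LocalFieldPadicProofs
import HarnessLib

/-!
# K1 over `ℚ_p` LITERALLY: the Kummer class of every `P ∈ E(ℚ_p)` dies in `H¹(ℚ_p, B_dR⁺ ⊗ V_pE)` (`W/ℤ` good supersingular, `p ≥ 5`)

Topic `Literature/NumberTheory/PAdicHodge`; namespace `Literature.NumberTheory.PAdicHodge.AinfTop`. THEOREMS ONLY (no definition, no
named fact, no instance, no `sorry`). The field hypothesis `{w ≤ 1} ⊆ ℤ_p` of ★★★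
`isFilZeroCoboundary_kummer_curveF_of_five_le_of_rational` (`KummerFilZeroCoboundaryRationalPoints`) is DISCHARGED for Mathlib's `ℚ_[p]`
with its valuative structure (`Mathlib.NumberTheory.Padics.ValuativeRel`) and the tree's proof that `ℚ_[p]` is a non-archimedean local
field (`Padic.isNonarchimedeanLocalField_holds`):

* `Padic.mulValuation_le_one_iff_norm`, `Padic.mulValuation_le_iff_norm_le`, `Padic.compatible_nnnorm`, `Padic.val_le_one_iff_norm` —
  Mathlib's `mulValuation` / any compatible `w` against the norm (`w x ≤ 1 ↔ ‖x‖ ≤ 1`; `‖·‖₊` is compatible);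
* `Padic.padicRingHom_eq_id` — the tree's `ℚ_p → ℚ_[p]` is the identity; `Padic.exists_padicInt_eq_of_val_le_one` — the hypothesis `hOF`;
* ★★★ **`isFilZeroCoboundary_kummer_padic_of_five_le`** — `W/ℤ` with `p ∤ Δ`, `A_p ≡ 0 (p)` (good supersingular), `p ≥ 5`; for EVERY
  `P ∈ E(ℚ_p)` and EVERY `p`-power division sequence `Q` of `P` in `E(ℚ̄_p)` the cocycle `σ ↦ 1 ⊗ (σQₙ − Qₙ)ₙ` is a `Fil⁰`-coboundary of
  `B_dR(ℚ_p) ⊗ V_pE`. Bloch–Kato Example 3.11 (`⊆`), cocycle level, no hypothesis beyond the curve data.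

Crux K★ `stmt-BirchSwinnertonDyer-22226`, K1 brick. BSD / K★ are not proved by any of this.

## References
* [BlochKato1990] S. Bloch, K. Kato (1990), Ex. 3.10.1, Example 3.11 (3.11.1).
* [SilvermanAEC2009] J. H. Silverman, *AEC* (2009), Prop. VII.2.1–VII.2.2, VII.6, VIII.§2.
* [SerreLocalFields1979] J.-P. Serre, *Local Fields* (1979), Ch. II §1, §5.
-/

noncomputable section

open scoped TensorProduct Classical NNReal

namespace Literature.NumberTheory.PAdicHodge

open Literature Literature.NumberTheory.GaloisRepresentations Literature.NumberTheory.EllipticCurves WeierstrassCurve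
open Literature.NumberTheory.GaloisRepresentations.IsNonarchimedeanLocalField Field ValuativeRel
open Literature.NumberTheory.GaloisRepresentations.LubinTate Literature.NumberTheory.EllipticCurves.FormalGroupChart

namespace AinfTop

section PadicField

variable {p : ℕ} [Fact p.Prime]

/-- `mulValuation x ≤ 1 ↔ ‖x‖ ≤ 1` on `ℚ_[p]`. [cite: SerreLocalFields1979, Ch. II §1] -/
theorem Padic.mulValuation_le_one_iff_norm (x : ℚ_[p]) : Padic.mulValuation x ≤ 1 ↔ ‖x‖ ≤ 1 := by
  by_cases hx : x = 0
  · subst hx; simp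
  · -- `mulValuation x = exp (−ord_p x)` off zero (tree: `WeierstrassCurve.padicMulValuation_apply_of_ne_zero`)
    have hmx : Padic.mulValuation x = WithZero.exp (-x.valuation) := by simp [Padic.mulValuation, hx]
    rw [hmx, ← WithZero.exp_zero, WithZero.exp_le_exp, Padic.norm_le_one_iff_val_nonneg, neg_nonpos]

/-- `mulValuation x ≤ mulValuation y ↔ ‖x‖ ≤ ‖y‖` on `ℚ_[p]`. [cite: SerreLocalFields1979, Ch. II §1] -/
theorem Padic.mulValuation_le_iff_norm_le (x y : ℚ_[p]) : Padic.mulValuation x ≤ Padic.mulValuation y ↔ ‖x‖ ≤ ‖y‖ := by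
  by_cases hy : y = 0
  · subst hy
    rw [map_zero, le_zero_iff, map_eq_zero, norm_zero, norm_le_zero_iff]
  by_cases hx : x = 0
  · subst hx
    simp only [map_zero, zero_le, norm_zero, norm_nonneg]
  have hp1 : (1 : ℝ) < p := by exact_mod_cast (Fact.out : p.Prime).one_lt
  have hmx : Padic.mulValuation x = WithZero.exp (-x.valuation) := by simp [Padic.mulValuation, hx]
  have hmy : Padic.mulValuation y = WithZero.exp (-y.valuation) := by simp [Padic.mulValuation, hy]
  rw [hmx, hmy, WithZero.exp_le_exp, Padic.norm_eq_zpow_neg_valuation hx, Padic.norm_eq_zpow_neg_valuation hy,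
    zpow_le_zpow_iff_right₀ hp1]

/-- **The norm valuation `‖·‖₊` of `ℚ_[p]` is compatible with Mathlib's valuative structure** (`.ofValuation mulValuation`).
[cite: SerreLocalFields1979, Ch. II §1] -/
theorem Padic.compatible_nnnorm : (NormedField.valuation (K := ℚ_[p])).Compatible :=
  ⟨fun x y => (Valuation.Compatible.vle_iff_le (v := Padic.mulValuation) x y).trans
    ((Padic.mulValuation_le_iff_norm_le x y).trans Iff.rfl)⟩

/-- `w x ≤ 1 ↔ ‖x‖ ≤ 1` for every valuation `w` of `ℚ_[p]` compatible with its valuative structure. [cite: SerreLocalFields1979, Ch. II §1] -/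
theorem Padic.val_le_one_iff_norm {Γ₀ : Type*} [LinearOrderedCommGroupWithZero Γ₀] (w : Valuation ℚ_[p] Γ₀) [w.Compatible]
    (x : ℚ_[p]) : w x ≤ 1 ↔ ‖x‖ ≤ 1 :=
  (ValuativeRel.isEquiv w Padic.mulValuation).le_one_iff_le_one.trans (Padic.mulValuation_le_one_iff_norm x)

/-- **The tree's `ℚ_p → ℚ_[p]` (`LocalField.padicRingHom`) is the identity** (uniqueness of ring maps `ℚ_p → K` integral on `ℤ_p`).
[cite: SerreLocalFields1979, Ch. II §5] -/
theorem Padic.padicRingHom_eq_id [TopologicalSpace ℚ_[p]] [IsNonarchimedeanLocalField ℚ_[p]] (h : valuation ℚ_[p] p < 1) :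
    LocalField.padicRingHom ℚ_[p] p h = RingHom.id ℚ_[p] :=
  (LocalField.eq_padicRingHom ℚ_[p] p h (RingHom.id ℚ_[p]) fun x : ℤ_[p] =>
    (Padic.val_le_one_iff_norm (valuation ℚ_[p]) (x : ℚ_[p])).2 x.norm_le_one).symm

/-- **`{w ≤ 1} ⊆ ℤ_p` in `ℚ_[p]`** — the hypothesis `hOF` of `isFilZeroCoboundary_kummer_curveF_of_five_le_of_rational` for `F = ℚ_[p]`.
[cite: SerreLocalFields1979, Ch. II §5] -/
theorem Padic.exists_padicInt_eq_of_val_le_one [TopologicalSpace ℚ_[p]] [IsNonarchimedeanLocalField ℚ_[p]] (h : valuation ℚ_[p] p < 1)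
    (w : Valuation ℚ_[p] ℝ≥0) [w.Compatible] (x : ℚ_[p]) (hx : w x ≤ 1) :
    ∃ c : ℤ_[p], LocalField.padicRingHom ℚ_[p] p h (c : ℚ_[p]) = x :=
  ⟨⟨x, (Padic.val_le_one_iff_norm w x).1 hx⟩, by rw [Padic.padicRingHom_eq_id]; rfl⟩

end PadicField

section Padic

variable (W : WeierstrassCurve ℤ) {p : ℕ} [Fact p.Prime]

/-- ★★★ **K1 over `ℚ_p`, literally.** `W/ℤ` with good supersingular reduction at `p ≥ 5` (`p ∤ Δ_W`, Hasse coefficient `≡ 0`); `ℚ_[p]`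
with Mathlib's valuative structure, a non-archimedean local field by `Padic.isNonarchimedeanLocalField_holds`. For EVERY rational point
`P ∈ E(ℚ_p)` and EVERY `p`-power division sequence `Q` of `P` in `E(ℚ̄_p)`, the algebraic Kummer cocycle `σ ↦ 1 ⊗ (σQₙ − Qₙ)ₙ` is a
`Fil⁰`-coboundary of `B_dR(ℚ_p) ⊗ V_pE`: the `p`-adic Kummer class of `P` dies in `H¹(ℚ_p, B_dR⁺ ⊗ V_pE)` (Bloch–Kato Example 3.11, `⊆`).
[cite: BlochKato1990, Ex. 3.10.1, Example 3.11 (3.11.1)] [cite: SilvermanAEC2009, Prop. VII.2.1–VII.2.2, VII.6 Cor. 6.2 and Ex. 7.6] -/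
theorem isFilZeroCoboundary_kummer_padic_of_five_le (hp5 : 5 ≤ p) (hΔ : ¬ (p : ℤ) ∣ W.Δ)
    (hA : (W.map (Int.castRingHom (ZMod p))).hasseCoeff p = 0) :
    haveI := Padic.isNonarchimedeanLocalField_holds p
    haveI : Fact (¬ IsUnit (p : integerC ℚ_[p])) := ⟨not_isUnit_natCast_integerC (Padic.valuation_p_lt_one (valuation ℚ_[p]))⟩
    haveI := isAdicComplete_integerC_natCast (F := ℚ_[p]) (Padic.valuation_p_lt_one (valuation ℚ_[p]))
    haveI := AinfTop.isElliptic_curveF_of_ne_zero (F := ℚ_[p]) W fun h => hΔ (h ▸ dvd_zero _)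
    ∀ (P : (curveF ℚ_[p] W).toAffine.Point) {Q : ℕ → (curveF ℚ_[p] W).geomPoints} (hQ : ∀ n, p • Q (n + 1) = Q n)
      (hQ0 : Q 0 = WeierstrassCurve.toGeomPoints (curveF ℚ_[p] W) P) (hfix : ∀ σ : absoluteGaloisGroup ℚ_[p], σ • Q 0 = Q 0),
      (bdRPeriodRingData (F := ℚ_[p]) (p := p) (Padic.valuation_p_lt_one (valuation ℚ_[p]))).IsFilZeroCoboundary
        (rationalTateRep (curveF ℚ_[p] W) p) fun σ =>
        ((1 : (bdRPeriodRingData (F := ℚ_[p]) (p := p) (Padic.valuation_p_lt_one (valuation ℚ_[p]))).B) ⊗ₜ[ℚ_[p]]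
          TateModule.toRational p (TateModule.mk (fun n => σ • Q n - Q n) (pow_smul_kummer_eq_zero W hQ hfix σ)
            (smul_kummer_succ W hQ σ)) :
          (bdRPeriodRingData (F := ℚ_[p]) (p := p) (Padic.valuation_p_lt_one (valuation ℚ_[p]))).B ⊗[ℚ_[p]]
            (curveF ℚ_[p] W).rationalTateModule p) := by
  haveI := Padic.isNonarchimedeanLocalField_holds p
  haveI : Fact (¬ IsUnit (p : integerC ℚ_[p])) := ⟨not_isUnit_natCast_integerC (Padic.valuation_p_lt_one (valuation ℚ_[p]))⟩
  haveI := isAdicComplete_integerC_natCast (F := ℚ_[p]) (Padic.valuation_p_lt_one (valuation ℚ_[p]))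
  haveI := AinfTop.isElliptic_curveF_of_ne_zero (F := ℚ_[p]) W fun h => hΔ (h ▸ dvd_zero _)
  intro P Q hQ hQ0 hfix
  haveI := isElliptic_curveOverC (F := ℚ_[p]) W fun h => hΔ (h ▸ dvd_zero _)
  haveI := Padic.compatible_nnnorm (p := p)
  exact isFilZeroCoboundary_kummer_curveF_of_five_le_of_rational W (Padic.valuation_p_lt_one (valuation ℚ_[p])) hp5 hΔ hA
    (NormedField.valuation (K := ℚ_[p]))
    (Padic.exists_padicInt_eq_of_val_le_one (Padic.valuation_p_lt_one (valuation ℚ_[p])) (NormedField.valuation (K := ℚ_[p])))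
    P hQ hQ0 hfix

end Padic

end AinfTop

end Literature.NumberTheory.PAdicHodge

end
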